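import Literature.LinearAlgebra.Matrix.FiniteRangeDecompositionMatrixSum
import Literature.LinearAlgebra.Matrix.TranslationInvariantMatrix
import Literature.LinearAlgebra.Matrix.HermitianCfcComplexification
import Literature.Probability.LatticeModels.SpaceTimeTorusCharacters
import HarnessLib

/-!
# The finite-range decomposition of a general translation-invariant finite-range form on the
# space-time torus `(ℤ/L)^d × ℤ/M` dominating a nearest-neighbour Laplacian: finite range,
# the decomposition identity with the averaging projection, and kernel bounds by momentum sums

Topic `Probability/LatticeModels`, namespace `Literature.Probability.LatticeModels`.  This file
assembles the matrix theory of `Literature/LinearAlgebra/Matrix/FiniteRangeDecompositionMatrix*.lean`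
(Bauerschmidt, PTRF 157 (2013), Thm. 1.2: the pieces `C_j = g_j(Q)`, positive semi-definite,
finite range `½L^j·range(Q)`, summing to the Green function) with the lattice harmonic analysis of
`SpaceTimeTorusCharacters.lean` and `TranslationInvariantMatrix.lean` into the statement a
renormalisation-group analysis on a finite torus consumes (Bauerschmidt 2013, §1.3 "the torus";
Bauerschmidt–Brydges–Slade, LNM 2242 (2019), Ch. 3–4; Brydges–Guadagni–Mitter, CMP 2004, for
the estimates one then wants): for a REAL SYMMETRIC TRANSLATION-INVARIANT form `Q` on
`Λ = (ℤ/L)^d × ℤ/M` with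

  (range)  `Q_{xy} = 0` if `dist(x,y) > R` (torus `ℓ¹`-distance),
  (lower)  `c₀ · Σ_i Σ_s (u_s - u_{s+E_i})² ≤ u·Qu` for a family of steps `E_i` (`c₀ > 0`),
  (upper)  `u·Qu ≤ 2Θ |u|²`,

the pieces `C_j = MatrixFRD.piece Q Θ L_* j` (`L_* ≥ 1` the scale ratio) satisfy:
`C_j ⪰ 0`, translation-invariant, symmetric under every symmetry of `Q`; `(C_j)_{xy} = 0` for
`dist(x,y) > R·½L_*^j`; if moreover `Q𝟙 = 0` and the steps generate `Λ`,
`Σ_{j≤N} C_j + C_N^♭ = Q⁺ + a_N |Λ|⁻¹𝟙𝟙ᵀ` (the non-local remainder is a constant matrix, invisible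
to increments); and THE KERNEL BOUND

  `|(C_j)_{xy}| ≤ |Λ|⁻¹ Σ_{(k,q) ∈ Λ} g(c₀ · Σ_i 2(1 - Re χ_{(k,q)}(E_i)))`

for every antitone majorant `g ≥ g_j` on `[0,∞)` — the entries of the pieces of the GENERAL form
are controlled by explicit momentum sums of the comparison Laplacian alone (no Fourier
diagonalisation of `Q` is used: `Q` and `c₀Δ_E` commute as convolution operators, and Weyl
monotonicity in a joint eigenbasis transfers the spectral sum).

## Contents

* `torusDist`, `torusDist_self`, `torusDist_triangle`, `torusDist_add_right`;
* `apply_add_nsmul_eq`, `eq_apply_zero_of_forall_unitStep` (a function invariant under the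
  `d+1` unit steps is constant), `unitSteps`, `eq_apply_zero_of_dirichlet_eq_zero`;
* `posSemidef_smul_stLaplacianR`, `posSemidef_sub_of_lower`, `posSemidef_of_lower`,
  `spectrum_le_of_upper`, `exists_const_of_mulVec_eq_zero`;
* **`torusFRD_piece_eq_zero_of_lt_dist`** (finite range), **`torusFRD_sum_eq`** (decomposition
  identity with the averaging projection), `torusFRD_mul_inv`;
* `stSymbol_smul`, `sum_eigenvalues_smul_stLaplacianR`, **`torusFRD_abs_piece_le`** (kernel bound).

## References

* R. Bauerschmidt, PTRF 157 (2013) 817–845, Thm. 1.2, §1.3. [Bauerschmidt2013]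
* R. Bauerschmidt, D. C. Brydges, G. Slade, LNM 2242 (2019), Ch. 3–4. [BauerschmidtBrydgesSlade2019RG]
-/

noncomputable section

open Matrix Finset MeasureTheory Set
open scoped ComplexConjugate Real MatrixOrder ComplexOrder
open Literature.LinearAlgebra.Matrix Literature.LinearAlgebra.Matrix.MatrixFRD

namespace Literature.Probability.LatticeModels

variable {d L M : ℕ} [NeZero L] [NeZero M]

/-! ### The torus distance -/

/-- **The `ℓ¹` distance of the space-time torus**: `dist(x,y) = Σ_i |x_i - y_i|_L + |x_t - y_t|_M`
with `|·|_n` the distance to `0` in `ℤ/n` (`ZMod.valMinAbs`). [folklore] -/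
def torusDist (x y : TorusSite d L × ZMod M) : ℝ :=
  (∑ i, (((x.1 - y.1) i).valMinAbs.natAbs : ℝ)) + (((x.2 - y.2).valMinAbs.natAbs : ℕ) : ℝ)

omit [NeZero L] [NeZero M] in
/-- `dist(x,x) = 0`. [folklore] -/
theorem torusDist_self (x : TorusSite d L × ZMod M) : torusDist x x = 0 := by
  simp [torusDist, ZMod.valMinAbs_zero]

omit [NeZero L] [NeZero M] in
/-- The triangle inequality for the torus distance. [folklore] -/
theorem torusDist_triangle (x y z : TorusSite d L × ZMod M) :
    torusDist x z ≤ torusDist x y + torusDist y z := by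
  unfold torusDist
  have hc : ∀ {n : ℕ} (a b : ZMod n), ((a + b).valMinAbs.natAbs : ℝ) ≤
      (a.valMinAbs.natAbs : ℝ) + (b.valMinAbs.natAbs : ℝ) := by
    intro n a b
    have h1 := ZMod.natAbs_valMinAbs_add_le a b
    have h2 := Int.natAbs_add_le a.valMinAbs b.valMinAbs
    exact_mod_cast h1.trans h2
  have hsp : ∀ i, (((x.1 - z.1) i).valMinAbs.natAbs : ℝ) ≤
      (((x.1 - y.1) i).valMinAbs.natAbs : ℝ) + (((y.1 - z.1) i).valMinAbs.natAbs : ℝ) := by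
    intro i
    have : (x.1 - z.1) i = (x.1 - y.1) i + (y.1 - z.1) i := by simp
    rw [this]
    exact hc _ _
  have ht : (((x.2 - z.2).valMinAbs.natAbs : ℕ) : ℝ) ≤
      (((x.2 - y.2).valMinAbs.natAbs : ℕ) : ℝ) + (((y.2 - z.2).valMinAbs.natAbs : ℕ) : ℝ) := by
    have : x.2 - z.2 = (x.2 - y.2) + (y.2 - z.2) := by abel
    rw [this]
    exact hc _ _
  have hsum := Finset.sum_le_sum fun i (_ : i ∈ Finset.univ) => hsp i
  rw [Finset.sum_add_distrib] at hsum
  linarith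

omit [NeZero L] [NeZero M] in
/-- The torus distance is translation-invariant. [folklore] -/
theorem torusDist_add_right (a x y : TorusSite d L × ZMod M) :
    torusDist (x + a) (y + a) = torusDist x y := by
  simp [torusDist]

/-! ### Functions invariant under the unit steps are constant -/

omit [NeZero L] [NeZero M] in
/-- Invariance under a step iterates: `u(x + n•v) = u(x)`. [folklore] -/
theorem apply_add_nsmul_eq {α : Type*} {u : TorusSite d L × ZMod M → α}
    {v : TorusSite d L × ZMod M} (hv : ∀ y, u (y + v) = u y) (x : TorusSite d L × ZMod M) (n : ℕ) :
    u (x + n • v) = u x := by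
  induction n with
  | zero => simp
  | succ n ih => rw [succ_nsmul, ← add_assoc, hv, ih]

/-- **A function on `(ℤ/L)^d × ℤ/M` invariant under the `d` spatial and the temporal unit steps
is constant.** [folklore] -/
theorem eq_apply_zero_of_forall_unitStep {α : Type*} {u : TorusSite d L × ZMod M → α}
    (hsp : ∀ (i : Fin d) (y : TorusSite d L × ZMod M), u (y + (Pi.single i 1, 0)) = u y)
    (ht : ∀ y : TorusSite d L × ZMod M, u (y + (0, 1)) = u y) (x : TorusSite d L × ZMod M) :
    u x = u 0 := by
  classical
  -- remove the time coordinate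
  have h1 : u x = u (x.1, 0) := by
    have hx : x = (x.1, (0 : ZMod M)) + x.2.val • ((0 : TorusSite d L), (1 : ZMod M)) := by
      ext
      · simp
      · simp
    conv_lhs => rw [hx]
    exact apply_add_nsmul_eq ht _ _
  rw [h1]
  -- remove the spatial coordinates one at a time
  suffices hS : ∀ (S : Finset (Fin d)) (k : TorusSite d L), (∀ i, i ∉ S → k i = 0) →
      u (k, 0) = u 0 by
    exact hS Finset.univ x.1 (fun i hi => absurd (Finset.mem_univ i) hi)
  intro S
  induction S using Finset.induction_on with
  | empty =>
      intro k hk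
      have : k = 0 := funext fun i => hk i (Finset.notMem_empty i)
      rw [this]
      rfl
  | insert i S hiS ih =>
      intro k hk
      set k' : TorusSite d L := k - (k i).val • Pi.single i 1 with hk'
      have hk'i : ∀ j, j ∉ S → k' j = 0 := by
        intro j hj
        by_cases hji : j = i
        · subst hji
          rw [hk', Pi.sub_apply, Pi.smul_apply, Pi.single_eq_same, nsmul_eq_mul, mul_one,
            ZMod.natCast_zmod_val, sub_self]
        · have hjS : j ∉ insert i S := by simp [hji, hj]
          simp [hk', Pi.single_eq_of_ne hji, hk j hjS]
      have hdecomp : ((k, (0 : ZMod M)) : TorusSite d L × ZMod M) =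
          (k', 0) + (k i).val • (Pi.single i (1 : ZMod L), (0 : ZMod M)) := by
        ext j
        · simp [hk', Prod.smul_mk]
        · simp
      rw [hdecomp, apply_add_nsmul_eq (hsp i), ih k' hk'i]

/-- **The `d+1` unit steps** of the space-time torus: `e_1, …, e_d` in space, `1` in time.
[folklore] -/
def unitSteps (d L M : ℕ) : Fin (d + 1) → TorusSite d L × ZMod M :=
  fun i => Fin.lastCases ((0 : TorusSite d L), (1 : ZMod M)) (fun j => (Pi.single j 1, 0)) i

omit [NeZero L] [NeZero M] in
/-- The unit steps: the last one is the time step, the others the space steps. [folklore] -/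
theorem unitSteps_last : unitSteps d L M (Fin.last d) = (0, 1) := by
  simp [unitSteps]

omit [NeZero L] [NeZero M] in
/-- The unit steps: the `j`-th (`j < d`) is the spatial unit vector `e_j`. [folklore] -/
theorem unitSteps_castSucc (j : Fin d) : unitSteps d L M j.castSucc = (Pi.single j 1, 0) := by
  simp [unitSteps]

/-- **Vanishing Dirichlet form along the unit steps forces a constant field.** [folklore] -/
theorem eq_apply_zero_of_dirichlet_eq_zero {u : TorusSite d L × ZMod M → ℝ}
    (h : ∑ i, ∑ s, (u s - u (s + unitSteps d L M i)) ^ 2 = 0) (x : TorusSite d L × ZMod M) :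
    u x = u 0 := by
  have hterm : ∀ i s, u s - u (s + unitSteps d L M i) = 0 := by
    intro i s
    have hi := (Finset.sum_eq_zero_iff_of_nonneg (fun i _ =>
      Finset.sum_nonneg fun s _ => sq_nonneg _)).mp h i (Finset.mem_univ i)
    have hs := (Finset.sum_eq_zero_iff_of_nonneg (fun s _ => sq_nonneg _)).mp hi s
      (Finset.mem_univ s)
    exact pow_eq_zero_iff (n := 2) (by norm_num) |>.mp hs
  refine eq_apply_zero_of_forall_unitStep (fun i y => ?_) (fun y => ?_) x
  · have := hterm i.castSucc y
    rw [unitSteps_castSucc] at this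
    linarith
  · have := hterm (Fin.last d) y
    rw [unitSteps_last] at this
    linarith

/-! ### Positivity, spectrum and kernel of a form dominating a Laplacian -/

/-- `c₀ Δ_E ⪰ 0` for `c₀ ≥ 0` (the Dirichlet form is nonnegative). [folklore] -/
theorem posSemidef_smul_stLaplacianR {m : ℕ} (E : Fin m → TorusSite d L × ZMod M) {c₀ : ℝ}
    (hc₀ : 0 ≤ c₀) : (c₀ • stLaplacianR E).PosSemidef := by
  refine PosSemidef.of_dotProduct_mulVec_nonneg ((stLaplacianR_isHermitian E).smul (IsSelfAdjoint.all c₀)) fun u => ?_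
  rw [star_trivial, Matrix.smul_mulVec, dotProduct_smul, dotProduct_stLaplacianR_mulVec,
    smul_eq_mul]
  exact mul_nonneg hc₀ (Finset.sum_nonneg fun i _ => Finset.sum_nonneg fun s _ => sq_nonneg _)

/-- **(lower) in the Loewner order**: `Q - c₀Δ_E ⪰ 0`. [folklore] -/
theorem posSemidef_sub_of_lower {Q : Matrix (TorusSite d L × ZMod M) (TorusSite d L × ZMod M) ℝ}
    (hQ : Q.IsHermitian) {m : ℕ} (E : Fin m → TorusSite d L × ZMod M) {c₀ : ℝ}
    (hlow : ∀ u, c₀ * ∑ i, ∑ s, (u s - u (s + E i)) ^ 2 ≤ u ⬝ᵥ Q *ᵥ u) :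
    (Q - c₀ • stLaplacianR E).PosSemidef := by
  refine PosSemidef.of_dotProduct_mulVec_nonneg (hQ.sub ((stLaplacianR_isHermitian E).smul (IsSelfAdjoint.all c₀)))
    fun u => ?_
  rw [star_trivial, Matrix.sub_mulVec, dotProduct_sub, Matrix.smul_mulVec, dotProduct_smul,
    dotProduct_stLaplacianR_mulVec, smul_eq_mul, sub_nonneg]
  exact hlow u

/-- A form dominating a nonnegative multiple of a Laplacian is positive semi-definite. [folklore] -/
theorem posSemidef_of_lower {Q : Matrix (TorusSite d L × ZMod M) (TorusSite d L × ZMod M) ℝ}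
    (hQ : Q.IsHermitian) {m : ℕ} (E : Fin m → TorusSite d L × ZMod M) {c₀ : ℝ} (hc₀ : 0 ≤ c₀)
    (hlow : ∀ u, c₀ * ∑ i, ∑ s, (u s - u (s + E i)) ^ 2 ≤ u ⬝ᵥ Q *ᵥ u) : Q.PosSemidef := by
  have h := (posSemidef_sub_of_lower hQ E hlow).add (posSemidef_smul_stLaplacianR E hc₀)
  rwa [sub_add_cancel] at h

/-- **(upper) bounds the spectrum**: `u·Qu ≤ CΘ|u|²` gives `spectrum Q ⊂ (-∞, CΘ]`. [folklore] -/
theorem spectrum_le_of_upper {Q : Matrix (TorusSite d L × ZMod M) (TorusSite d L × ZMod M) ℝ}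
    (hQ : Q.IsHermitian) {C : ℝ} (hup : ∀ u, u ⬝ᵥ Q *ᵥ u ≤ C * (u ⬝ᵥ u)) :
    ∀ μ ∈ spectrum ℝ Q, μ ≤ C := by
  refine spectrum_le_of_posSemidef_sub hQ (PosSemidef.of_dotProduct_mulVec_nonneg ?_ fun u => ?_)
  · exact (Matrix.isHermitian_one.smul (IsSelfAdjoint.all C)).sub hQ
  · rw [star_trivial, Matrix.sub_mulVec, dotProduct_sub, Matrix.smul_mulVec, dotProduct_smul,
      Matrix.one_mulVec, smul_eq_mul, sub_nonneg]
    exact hup u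

/-- **The kernel of a form dominating `c₀Δ` along generating steps is the constants.**
[folklore] -/
theorem exists_const_of_mulVec_eq_zero
    {Q : Matrix (TorusSite d L × ZMod M) (TorusSite d L × ZMod M) ℝ} {c₀ : ℝ} (hc₀ : 0 < c₀)
    (hlow : ∀ u, c₀ * ∑ i, ∑ s, (u s - u (s + unitSteps d L M i)) ^ 2 ≤ u ⬝ᵥ Q *ᵥ u)
    (u : TorusSite d L × ZMod M → ℝ) (hu : Q *ᵥ u = 0) : ∃ c : ℝ, u = fun _ => c := by
  have hD : ∑ i, ∑ s, (u s - u (s + unitSteps d L M i)) ^ 2 = 0 := by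
    have h := hlow u
    rw [hu, dotProduct_zero] at h
    have hnn : 0 ≤ ∑ i, ∑ s, (u s - u (s + unitSteps d L M i)) ^ 2 :=
      Finset.sum_nonneg fun i _ => Finset.sum_nonneg fun s _ => sq_nonneg _
    nlinarith
  exact ⟨u 0, funext fun x => eq_apply_zero_of_dirichlet_eq_zero hD x⟩

/-! ### Finite range and the decomposition identity on the torus -/

/-- **FINITE RANGE of the pieces on the torus.**  For a symmetric form `Q` on `(ℤ/L)^d × ℤ/M`
with (range) `Q_{xy} = 0` if `dist(x,y) > R` (`R ≥ 0`), (lower) along any steps with `c₀ ≥ 0`,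
and (upper) `u·Qu ≤ 2Θ|u|²` (`Θ > 0`): `(C_j)_{xy} = 0` whenever `dist(x,y) > R·½L_*^j`
(`L_* ≥ 0`, `j ≥ 1`). [cite: Bauerschmidt2013, Thm. 1.2 (finite range of the pieces), §1.3 (torus)] -/
theorem torusFRD_piece_eq_zero_of_lt_dist
    {Q : Matrix (TorusSite d L × ZMod M) (TorusSite d L × ZMod M) ℝ} (hQ : Q.IsHermitian)
    {m : ℕ} (E : Fin m → TorusSite d L × ZMod M) {c₀ : ℝ} (hc₀ : 0 ≤ c₀)
    (hlow : ∀ u, c₀ * ∑ i, ∑ s, (u s - u (s + E i)) ^ 2 ≤ u ⬝ᵥ Q *ᵥ u)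
    {Θ : ℝ} (hΘ : 0 < Θ) (hup : ∀ u, u ⬝ᵥ Q *ᵥ u ≤ 2 * Θ * (u ⬝ᵥ u))
    {R : ℝ} (hR : 0 ≤ R) (hQR : ∀ x y, R < torusDist x y → Q x y = 0)
    {Lrg : ℝ} (hLrg : 0 ≤ Lrg) {j : ℕ} (hj : 1 ≤ j) (x y : TorusSite d L × ZMod M)
    (hxy : R * (Lrg ^ j / 2) < torusDist x y) :
    piece Q Θ Lrg j x y = 0 := by
  have hsp : ∀ μ ∈ spectrum ℝ Q, μ ≤ 4 * Θ := fun μ hμ =>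
    (spectrum_le_of_upper hQ hup μ hμ).trans (by linarith)
  exact piece_apply_eq_zero_of_lt_dist (posSemidef_of_lower hQ E hc₀ hlow) hΘ hsp
    torusDist_triangle torusDist_self hR hQR hLrg hj x y hxy

/-- **THE DECOMPOSITION IDENTITY on the torus, with the averaging projection.**  If in addition
`Q𝟙 = 0` and (lower) holds along the unit steps (`c₀ > 0`), then for `L_* ≥ 1` and every `N`:
`Σ_{j=1}^{N} C_j + C_N^♭ = Q⁺ + a_N · |Λ|⁻¹𝟙𝟙ᵀ`, `a_N = Σ_{j≤N} g_j(0) ≥ 0` — the remainder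
beyond the finite-range pieces and the Green function `Q⁺` on mean-zero fields is a CONSTANT
matrix. [cite: Bauerschmidt2013, Thm. 1.2 and §1.3 (the torus)] -/
theorem torusFRD_sum_eq
    {Q : Matrix (TorusSite d L × ZMod M) (TorusSite d L × ZMod M) ℝ} (hQ : Q.IsHermitian)
    {c₀ : ℝ} (hc₀ : 0 < c₀)
    (hlow : ∀ u, c₀ * ∑ i, ∑ s, (u s - u (s + unitSteps d L M i)) ^ 2 ≤ u ⬝ᵥ Q *ᵥ u)
    {Θ : ℝ} (hΘ : 0 < Θ) (hup : ∀ u, u ⬝ᵥ Q *ᵥ u ≤ 2 * Θ * (u ⬝ᵥ u))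
    (h1 : Q *ᵥ (fun _ => (1 : ℝ)) = 0) {Lrg : ℝ} (hLrg : 1 ≤ Lrg) (N : ℕ) :
    (∑ j ∈ Finset.Icc 1 N, piece Q Θ Lrg j) + top Q Θ Lrg N =
      cfc (fun μ : ℝ => μ⁻¹) Q + (∑ j ∈ Finset.Icc 1 N, gFun Θ Lrg j 0) •
        ((Fintype.card (TorusSite d L × ZMod M) : ℝ)⁻¹ •
          Matrix.of (fun _ _ : TorusSite d L × ZMod M => (1 : ℝ))) := by
  rw [sum_piece_add_top (posSemidef_of_lower hQ _ hc₀.le hlow) hΘ (spectrum_le_of_upper hQ hup)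
    hLrg N, cfc_indicator_eq_average hQ h1 (exists_const_of_mulVec_eq_zero hc₀ hlow)]

/-- `Q Q⁺ = 1 - |Λ|⁻¹𝟙𝟙ᵀ`: `Q⁺ = cfc (·⁻¹) Q` inverts `Q` on the mean-zero fields.
[cite: Bauerschmidt2013, §1.3 (the torus: the form restricted to the complement of constants)] -/
theorem torusFRD_mul_inv
    {Q : Matrix (TorusSite d L × ZMod M) (TorusSite d L × ZMod M) ℝ} (hQ : Q.IsHermitian)
    {c₀ : ℝ} (hc₀ : 0 < c₀)
    (hlow : ∀ u, c₀ * ∑ i, ∑ s, (u s - u (s + unitSteps d L M i)) ^ 2 ≤ u ⬝ᵥ Q *ᵥ u)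
    (h1 : Q *ᵥ (fun _ => (1 : ℝ)) = 0) :
    Q * cfc (fun μ : ℝ => μ⁻¹) Q =
      1 - (Fintype.card (TorusSite d L × ZMod M) : ℝ)⁻¹ •
        Matrix.of (fun _ _ : TorusSite d L × ZMod M => (1 : ℝ)) := by
  rw [mul_cfc_inv hQ, cfc_indicator_eq_average hQ h1 (exists_const_of_mulVec_eq_zero hc₀ hlow)]

/-! ### The kernel bound by momentum sums -/

/-- The symbol is linear: `(cP)^ = c P̂`. [folklore] -/
theorem stSymbol_smul (c : ℂ) (P : Matrix (TorusSite d L × ZMod M) (TorusSite d L × ZMod M) ℂ)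
    (k : TorusSite d L × ZMod M) : stSymbol (c • P) k = c * stSymbol P k := by
  simp only [stSymbol, Matrix.smul_apply, smul_eq_mul, Finset.mul_sum, mul_assoc]

/-- **Spectral sums of `c₀Δ_E` are momentum sums**:
`Σ_k g(λ_k(c₀Δ_E)) = Σ_{(k,q)} g(c₀ · Σ_i 2(1 - Re χ_{(k,q)}(E_i)))` (real matrix on the left,
Mathlib's eigenvalue enumeration). [cite: CeccherinisilbersteScarabottiTolli2018, §2.4, Corollaries 2.4.11–2.4.12] -/
theorem sum_eigenvalues_smul_stLaplacianR {m : ℕ} (E : Fin m → TorusSite d L × ZMod M) (c₀ : ℝ)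
    (hP : (c₀ • stLaplacianR E).IsHermitian) (g : ℝ → ℝ) :
    ∑ k, g (hP.eigenvalues k) =
      ∑ kq : TorusSite d L × ZMod M, g (c₀ * ∑ i, 2 * (1 - (stChar kq (E i)).re)) := by
  have hPc := isHermitian_map_ofReal hP
  rw [← sum_eigenvalues_map_ofReal hP hPc g]
  have hmap : (c₀ • stLaplacianR E).map (algebraMap ℝ ℂ) = (c₀ : ℂ) • stLaplacian E := by
    rw [stLaplacian_eq_map]
    ext x y
    simp [Matrix.map_apply]
  have hPt : ∀ a x y, ((c₀ • stLaplacianR E).map (algebraMap ℝ ℂ)) (x + a) (y + a) =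
      ((c₀ • stLaplacianR E).map (algebraMap ℝ ℂ)) x y := by
    intro a x y
    simp only [hmap, Matrix.smul_apply, stLaplacian_translationInvariant]
  have hreal : ∀ x y, conj (((c₀ • stLaplacianR E).map (algebraMap ℝ ℂ)) x y) =
      ((c₀ • stLaplacianR E).map (algebraMap ℝ ℂ)) x y := fun x y => by
    rw [Matrix.map_apply]; exact Complex.conj_ofReal _
  have hsymm : ∀ x y, ((c₀ • stLaplacianR E).map (algebraMap ℝ ℂ)) x y =
      ((c₀ • stLaplacianR E).map (algebraMap ℝ ℂ)) y x := fun x y => by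
    simp only [Matrix.map_apply, Matrix.smul_apply, stLaplacianR_symm]
  rw [sum_eigenvalues_eq_sum_stSymbol hPc hPt hreal hsymm g]
  refine Finset.sum_congr rfl fun kq _ => ?_
  rw [hmap, stSymbol_smul, Complex.re_ofReal_mul, re_stSymbol_stLaplacian]

/-- **THE KERNEL BOUND.**  For a symmetric translation-invariant form `Q` on `(ℤ/L)^d × ℤ/M`
with (lower) `c₀ Σ_iΣ_s(u_s - u_{s+E_i})² ≤ u·Qu` (`c₀ ≥ 0`), `Θ > 0`, `L_* ≥ 0`, and any
majorant `g` of the scale function `g_j` on `[0,∞)` which is antitone there: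

  `|(C_j)_{xy}| ≤ |Λ|⁻¹ Σ_{(k,q)} g(c₀ · Σ_i 2(1 - Re χ_{(k,q)}(E_i)))`.

(The entries of the pieces of the general form are bounded by momentum sums of the comparison
Laplacian: `Q` and `c₀Δ_E` commute as convolution operators, and the antitone `g` is summed
over jointly ordered eigenvalues.) [cite: Bauerschmidt2013, Thm. 1.2 with §3 (bounds on the pieces through the spectral representation)] -/
theorem torusFRD_abs_piece_le
    {Q : Matrix (TorusSite d L × ZMod M) (TorusSite d L × ZMod M) ℝ} (hQ : Q.IsHermitian)
    (hQt : ∀ a x y, Q (x + a) (y + a) = Q x y)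
    {m : ℕ} (E : Fin m → TorusSite d L × ZMod M) {c₀ : ℝ} (hc₀ : 0 ≤ c₀)
    (hlow : ∀ u, c₀ * ∑ i, ∑ s, (u s - u (s + E i)) ^ 2 ≤ u ⬝ᵥ Q *ᵥ u)
    {Θ : ℝ} (hΘ : 0 < Θ) {Lrg : ℝ} (hLrg : 0 ≤ Lrg) (j : ℕ)
    {g : ℝ → ℝ} (hfg : ∀ μ, 0 ≤ μ → gFun Θ Lrg j μ ≤ g μ) (hg : AntitoneOn g (Set.Ici 0))
    (x y : TorusSite d L × ZMod M) :
    |piece Q Θ Lrg j x y| ≤ (Fintype.card (TorusSite d L × ZMod M) : ℝ)⁻¹ *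
      ∑ kq : TorusSite d L × ZMod M, g (c₀ * ∑ i, 2 * (1 - (stChar kq (E i)).re)) := by
  have hP : (c₀ • stLaplacianR E).IsHermitian := (stLaplacianR_isHermitian E).smul (IsSelfAdjoint.all c₀)
  have hPt : ∀ a x y, (c₀ • stLaplacianR E) (x + a) (y + a) = (c₀ • stLaplacianR E) x y := by
    intro a x y
    simp only [Matrix.smul_apply, stLaplacianR_translationInvariant]
  have h := norm_cfc_apply_le_sum_eigenvalues_of_le (𝕜 := ℝ) hQ hP hQt hPt
    (posSemidef_sub_of_lower hQ E hlow) (posSemidef_smul_stLaplacianR E hc₀)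
    (f := gFun Θ Lrg j) (fun μ _ => gFun_nonneg hΘ hLrg j μ) hfg hg x y
  rw [Real.norm_eq_abs, sum_eigenvalues_smul_stLaplacianR E c₀ hP g] at h
  exact h

end Literature.Probability.LatticeModels

end
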